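import Summits.ResolutionOfSingularities.ResolutionOfSingularities.Theorems.WeightedInvariantIota3DropCurveDatum
import Summits.ResolutionOfSingularities.ResolutionOfSingularities.Theorems.WeightedInvariantIota3AdaptedAdmissible
import HarnessLib

/-!
# The Abramovich–Quek–Schober datum of `f/1` at the canonical CURVE centre `P` DESCENDS to a regular system of parameters of `S`
# (door `HypersurfaceCentreConstruction`, stmt-ResolutionOfSingularities-19897; residual (D-b³-curve-TIE) of `stub_keyRungGrHomLE_three`)

Helper for `stub_keyRungGrHomLE_three` (def-free, `--supports 19897`).  Sequel of …Iota3DropCurveDatum (the integer-contact datum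
`(y, x, z; b; ν)`, `J₃ᵗ = 𝒥((y, x); (b, 1))`) and …Iota3AdaptedAdmissible ((ADAPT-adm) tie-free form).

* **`Iota3.exists_curve_aqs_datum`** — at a curve centre `P ≠ 𝔪` of a three-dimensional door position (`S` regular local essentially of
  finite type over a field, `0 ≠ f ∈ 𝔪`, `topStratum ι₀ S f = V(P)`, `S ⧸ P` regular, `¬ dim S_P ≤ 1`) there are a regular system of parameters
  `(x, y, z)` of `S` with `P = (x, y)`, coprime weights `0 < q ≤ r` and `ν = ord f` such that `(y/1, x/1; r, q; rν)` IS the lex-maximal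
  admissible weighted centre germ of `(f/1) ⊆ S_P` (`IsLexMaxWeightedCentreGerm`, Abramovich–Quek–Schober Thm 3.5): THE AQS CONTACT
  PARAMETER IS A REGULAR PARAMETER `y ∈ P ⊆ S`.  (AQS existence at `S_P`: `AQSHeightTwo.exists_isLexMaxWeightedCentreGerm`, its
  non-monomial input from `JFlatEssSmooth.not_isMonomialType_of_topStratumPrime_eq`; descent `exists_adapted_of_admissible` (`q < r`),
  any adapted rsp (`q = r = 1`); `isLexMaxWeightedCentreGerm_of_admissible`.)
* `Iota3.ringKrullDim_localization_eq_two_of_curveCentre` (`dim S_P = 2`), `Iota3.exists_isLexMax_of_eq` (transport along `I = J`).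

USE (CURVE-TIE.md §3, crux directory).  With this `y` and `b = ⌊r/q⌋` every monomial `x^i y^j z^k` (`j < ν`) of `f` has `i ≥ (r/q)(ν−j)`,
`> b(ν−j)` when `r/q ∉ ℕ`, so the strict transform of `f` in the `x`-chart of the cobordant blow-up of `J₃ᵗ` is `≡ c Y^ν (mod s)`: the
residual (D-b³-curve-TIE) concerns the single successor `(s, Y, z)` over `𝔪`, where `(ν, ε, τ)` persist and `σ₁` must drop; and when
`r/q = b ∈ ℕ` an integer tie is an AQS tie (`IsTiePresentation`), excluded in the curve regime (`τ = 0`).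
[OURS · L1 W4.3 · audit glue; AI work, weaker than expert review; nothing here is a statement of the manuscript under review.]

## References

* D. Abramovich, M. H. Quek, B. Schober, arXiv:2507.01232 (2025), Thm 1.3 (1), Thm 3.5. [AbramovichQuekSchober2025]
* H. Matsumura, *Commutative Ring Theory* (1987), Thm. 14.2, §5. [Matsumura1987]
-/

noncomputable section

set_option linter.dupNamespace false -- mandated namespace of this single-conjunct summit

open IsLocalRing Literature.AlgebraicGeometry.Resolution
open Summit.ResolutionOfSingularities.ResolutionOfSingularities.Theorems
open Summit.ResolutionOfSingularities.ResolutionOfSingularities.Theorems.ContactCylinder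

namespace Summit.ResolutionOfSingularities.ResolutionOfSingularities.Cruxes.HypersurfaceCentreConstruction.LocalEngine

namespace Iota3

/-! ## The Abramovich–Quek–Schober datum of `f/1` at `S_P` descends to a regular system of parameters of `S` -/

/-- Transport of a lex-maximal germ read at `Localization.AtPrime I` along an equality of ideals `I = J`. [folklore] -/
theorem exists_isLexMax_of_eq {T : Type} [CommRing T] {I J : Ideal T} [hI : I.IsPrime] (hIJ : I = J) {g a b : T}
    {w : Fin 2 → ℕ} {ℓ : ℕ}
    (h : IsLexMaxWeightedCentreGerm (Localization.AtPrime I) (Ideal.span {algebraMap T (Localization.AtPrime I) g})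
      ![algebraMap T (Localization.AtPrime I) a, algebraMap T (Localization.AtPrime I) b] w ℓ) :
    ∃ (_ : J.IsPrime), IsLexMaxWeightedCentreGerm (Localization.AtPrime J) (Ideal.span {algebraMap T (Localization.AtPrime J) g})
      ![algebraMap T (Localization.AtPrime J) a, algebraMap T (Localization.AtPrime J) b] w ℓ := by
  subst hIJ; exact ⟨hI, h⟩

/-- **At a curve centre `dim S_P = 2`** (as a natural number): `S` regular local of Krull dimension `3`, `P ≠ 𝔪` prime with
`¬ dim S_P ≤ 1`. [cite: Matsumura1987, §5] -/
theorem ringKrullDim_localization_eq_two_of_curveCentre {S : Type} [CommRing S] [IsRegularLocalRing S] (hd : ringKrullDim S = 3)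
    (P : Ideal S) [P.IsPrime] (hP1 : ¬ ringKrullDim (Localization.AtPrime P) ≤ 1) (hPm : P ≠ maximalIdeal S) :
    ringKrullDim (Localization.AtPrime P) = (2 : ℕ) := by
  have hdle : ringKrullDim S ≤ 3 := le_of_eq hd
  obtain ⟨hP, hhP, -⟩ := exists_height_eq_nat_of_ringKrullDim_le_three hdle P
  have hP2 : ringKrullDim (Localization.AtPrime P) ≤ 2 := ringKrullDim_localization_le_two_of_ne hdle P hPm
  rw [IsLocalization.AtPrime.ringKrullDim_eq_height P (Localization.AtPrime P), hhP] at hP1 hP2 ⊢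
  have hcoe : ∀ a b : ℕ, ((a : ℕ∞) : WithBot ℕ∞) ≤ ((b : ℕ∞) : WithBot ℕ∞) ↔ a ≤ b := fun a b => by
    rw [WithBot.coe_le_coe, ENat.coe_le_coe]
  have h2 : hP = 2 := by
    have h2' : hP ≤ 2 := (hcoe hP 2).mp hP2
    have h1' : ¬ hP ≤ 1 := fun h => hP1 ((hcoe hP 1).mpr h)
    omega
  rw [h2]; rfl

/-- **THE AQS DATUM OF `f/1` AT `S_P` DESCENDS TO `S` (curve centre of a door position).**  `S` regular local essentially of finite type over
a field, `ringKrullDim S = 3`, `0 ≠ f ∈ 𝔪`; canonical centre `P ≠ 𝔪` (`topStratum ι₀ S f = V(P)`, `S ⧸ P` regular, `¬ dim S_P ≤ 1`).  Then there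
are a regular system of parameters `(x, y, z)` of `S` with `P = (x, y)`, coprime weights `0 < q ≤ r` and `ν = ord f ≥ 1` (`f ∈ 𝔪^ν ∖ 𝔪^{ν+1}`)
such that `(y/1, x/1; r, q; rν)` IS the lex-maximal admissible weighted centre germ of `(f/1) ⊆ S_P` (Abramovich–Quek–Schober Thm 3.5) — i.e.
the AQS contact parameter is a regular parameter `y ∈ P ⊆ S`.  (AQS existence at `S_P` `AQSHeightTwo.exists_isLexMaxWeightedCentreGerm`;
descent `exists_adapted_of_admissible` for `q < r`, any adapted rsp for `q = r = 1`; lex-maximality of the descended pair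
`isLexMaxWeightedCentreGerm_of_admissible`.)  With `b = ⌊r/q⌋` the integer contact level of …Iota3DropCurveDatum this is the `y` for which the
strict transform in the `x`-chart is `≡ c Y^ν (mod s)` (CURVE-TIE.md §3). [OURS · L1 W4.3 · (D-b³-curve-TIE) tool]
[cite: AbramovichQuekSchober2025, Thm 1.3 (1), Thm 3.5] [cite: Matsumura1987, Thm. 14.2] -/
theorem exists_curve_aqs_datum (k₀ : Type) [Field k₀]
    (S : Type) [CommRing S] [Algebra k₀ S] [Algebra.EssFiniteType k₀ S] [IsRegularLocalRing S]
    (f : S) (hd : ringKrullDim S = 3) (hf0 : f ≠ 0) (hf : f ∈ maximalIdeal S)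
    (P : Ideal S) [P.IsPrime] (hreg : IsRegularLocalRing (S ⧸ P))
    (hE : topStratum iotaOrdEpsTau S f = {𝔮 | P ≤ 𝔮.asIdeal}) (hP1 : ¬ ringKrullDim (Localization.AtPrime P) ≤ 1)
    (hPm : P ≠ maximalIdeal S) :
    ∃ (x y z : S) (q r ν : ℕ) (_ : (Ideal.span ({x, y} : Set S)).IsPrime),
      Ideal.span {x, y, z} = maximalIdeal S ∧ P = Ideal.span {x, y} ∧ 0 < q ∧ q ≤ r ∧ 1 ≤ ν ∧
      f ∈ maximalIdeal S ^ ν ∧ f ∉ maximalIdeal S ^ (ν + 1) ∧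
      IsLexMaxWeightedCentreGerm (Localization.AtPrime (Ideal.span ({x, y} : Set S)))
        (Ideal.span {algebraMap S (Localization.AtPrime (Ideal.span ({x, y} : Set S))) f})
        ![algebraMap S (Localization.AtPrime (Ideal.span ({x, y} : Set S))) y,
          algebraMap S (Localization.AtPrime (Ideal.span ({x, y} : Set S))) x] ![r, q] (r * ν) := by
  classical
  haveI : IsDomain S := isDomain_of_isRegularLocalRing S
  have hdle : ringKrullDim S ≤ 3 := le_of_eq hd
  have hd3 : ringKrullDim S = (3 : ℕ) := by rw [hd]; rfl
  have hrk : (maximalIdeal S).spanFinrank = 3 := by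
    have h := IsRegularLocalRing.spanFinrank_maximalIdeal (R := S)
    rw [hd3] at h
    exact_mod_cast h
  -- the order `ν` of `f` and equimultiplicity along `V(P)`
  obtain ⟨ν, hν⟩ := Ordinal.lt_omega0.mp (iotaOrd_lt_omega0_of_ne_zero S hf0)
  obtain ⟨hfν, hfν1⟩ := (iotaOrd_eq_natCast_iff S f ν).mp hν
  have hP₀ : topStratumPrime iotaOrdEpsTau S f = P :=
    ContactCylinder.topStratumPrime_eq_of_topStratum_eq iotaOrdEpsTau S f hE
  obtain ⟨_, -, -, -, -, hfPν⟩ := topStratumPrime_iotaOrdEpsTau_spec hdle hf0 hf hν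
  rw [hP₀] at hfPν
  have hν1 : 1 ≤ ν := by
    by_contra h
    have h0 : ν = 0 := by omega
    rw [h0, zero_add, pow_one] at hfν1
    exact hfν1 hf
  -- dimensions; an adapted regular system of parameters `(u, v, z)`, `(u, v) = P`
  have hdimO : ringKrullDim (Localization.AtPrime P) = (2 : ℕ) := ringKrullDim_localization_eq_two_of_curveCentre hd P hP1 hPm
  have hq1 : ringKrullDim (S ⧸ P) = 1 := ringKrullDim_quotient_eq_one_of_curveCentre hd P hreg hP1 hPm
  haveI := hreg
  obtain ⟨u, v, z, huvz, huv⟩ := exists_rsp_adapted hd3 P hq1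
  subst huv
  have hr₀ : Ideal.span (Set.range ![u, v, z]) = maximalIdeal S := by rw [range_three]; exact huvz
  have hxg : ∀ i, (![u, v] : Fin 2 → S) i ∈ maximalIdeal S := LocalGameEFTCylinder.mem_maximalIdeal_pair hr₀
  have hli := LocalGameEFTCylinder.linearIndependent_toCotangent_pair hr₀ hrk
  -- the position `(S_P, f/1)`
  set O := Localization.AtPrime (Ideal.span ({u, v} : Set S)) with hO
  haveI : IsRegularLocalRing O := isRegularLocalRing_localization_atPrime S _
  haveI : IsDomain O := isDomain_of_isRegularLocalRing O
  haveI : Algebra.EssFiniteType k₀ O := Algebra.EssFiniteType.comp k₀ S O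
  have hf0' : algebraMap S O f ≠ 0 := fun h =>
    hf0 ((injective_iff_map_eq_zero _).mp
      (IsLocalization.injective O (Ideal.span ({u, v} : Set S)).primeCompl_le_nonZeroDivisors) f h)
  obtain ⟨hmax₀, hv2, -, -⟩ := Descent.pair_facts (Ideal.span ({u, v} : Set S)) hxg hli rfl
  have hnm : ¬ IsMonomialType (algebraMap S O f) :=
    JFlatEssSmooth.not_isMonomialType_of_topStratumPrime_eq hdle hf0 hf u v hxg hli hP₀
  have hny : ∀ w : O, w ∈ maximalIdeal O → w ∉ maximalIdeal O ^ 2 → ∀ n : ℕ,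
      Ideal.span {algebraMap S O f} ≠ Ideal.span {w ^ n} := by
    intro w hw hw2 n heq
    obtain ⟨c, hc⟩ := Ideal.span_singleton_eq_span_singleton.mp heq.symm
    exact hnm ⟨(c : O), w, n, c.isUnit, hw, hw2, by rw [← hc, mul_comm]⟩
  have hιP : iotaOrd O (algebraMap S O f) = iotaOrd S f :=
    EquimultipleCentre.iotaOrd_localization_eq_of_mem_pow (Ideal.span ({u, v} : Set S)) le_rfl hν hfPν
  obtain ⟨hfνO, hfνO1⟩ := (iotaOrd_eq_natCast_iff O _ ν).mp (hιP.trans hν)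
  -- Abramovich–Quek–Schober existence at `O`
  have hdimO2 : ringKrullDim O = 2 := hdimO.trans rfl
  obtain ⟨x₁, y₁, q, r, ν₁, -, hν₁, hν₁1, hq, hqr, hx₁y₁, hlexO⟩ :=
    AQSHeightTwo.exists_isLexMaxWeightedCentreGerm O k₀ hdimO2 (algebraMap S O f) hf0' hny
  obtain rfl : ν = ν₁ := eq_of_mem_pow_of_not_mem_pow hfνO hfνO1 hν₁ hν₁1
  have hadm₁ : algebraMap S O f ∈ weightedMonomialIdeal ![y₁, x₁] ![r, q] (r * ν) :=
    (Ideal.span_singleton_le_iff_mem _).mp hlexO.2.2.2.2.2.2.1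
  have hmapP : ∀ {x y : S}, Ideal.span ({u, v} : Set S) = Ideal.span {x, y} →
      Ideal.span (Set.range ![algebraMap S O y, algebraMap S O x]) = maximalIdeal O := by
    intro x y hxy
    have h1 : (Ideal.span ({x, y} : Set S)).map (algebraMap S O) = (Ideal.span ({u, v} : Set S)).map (algebraMap S O) :=
      congrArg _ hxy.symm
    rw [show Set.range ![algebraMap S O y, algebraMap S O x] = {algebraMap S O y, algebraMap S O x} by
        rw [Matrix.range_cons, Matrix.range_cons, Matrix.range_empty, Set.union_empty, Set.singleton_union],
      show Ideal.span {algebraMap S O y, algebraMap S O x} = Ideal.span {algebraMap S O x, algebraMap S O y} from Ideal.span_pair_comm,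
      ← map_span_pair (algebraMap S O) x y, h1]
    exact Localization.AtPrime.map_eq_maximalIdeal
  rcases hqr.eq_or_lt with hqr_eq | hlt
  · -- `q = r (= 1)`: the pair `(u, v)` itself is admissible
    subst hqr_eq
    have hq1' : q = 1 := by
      have hc : Nat.Coprime q q := hlexO.2.2.1
      unfold Nat.Coprime at hc
      rwa [Nat.gcd_self] at hc
    subst hq1'
    have hadm : Ideal.span {algebraMap S O f} ≤ weightedMonomialIdeal ![algebraMap S O v, algebraMap S O u] ![1, 1] (1 * ν) := by
      rw [Ideal.span_singleton_le_iff_mem, one_mul, LocalGameEFTSteepening.weightedMonomialIdeal_one_eq_pow,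
        show Ideal.span {algebraMap S O v, algebraMap S O u} = Ideal.span {algebraMap S O u, algebraMap S O v} from Ideal.span_pair_comm]
      have h2 : algebraMap S O f ∈ (Ideal.span ({u, v} : Set S) ^ ν).map (algebraMap S O) := Ideal.mem_map_of_mem _ hfPν
      rwa [Ideal.map_pow, map_span_pair (algebraMap S O) u v] at h2
    have hlex := isLexMaxWeightedCentreGerm_of_admissible hlexO (hmapP rfl) hadm
    exact ⟨u, v, z, 1, 1, ν, inferInstance, huvz, rfl, hq, le_rfl, hν1, hfν, hfν1, hlex⟩
  · -- `q < r`: descent of the AQS contact parameter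
    obtain ⟨x, y, z', hPxy, hxyz, hPeq, hm⟩ := exists_adapted_of_admissible S hd3 huvz hq1 hν1 hfPν hfν1 hdimO hq hlt
      ⟨y₁, x₁, hx₁y₁, hadm₁⟩
    -- read the admissibility back at `O` and transfer lex-maximality, then move to `Localization.AtPrime (x, y)`
    obtain ⟨_, hmO⟩ := exists_adm_of_eq S hPeq.symm (a := y) (b := x) hm
    have hadm : Ideal.span {algebraMap S O f} ≤ weightedMonomialIdeal ![algebraMap S O y, algebraMap S O x] ![r, q] (r * ν) :=
      (Ideal.span_singleton_le_iff_mem _).mpr hmO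
    have hlex := isLexMaxWeightedCentreGerm_of_admissible hlexO (hmapP hPeq) hadm
    obtain ⟨hPxy', hlex'⟩ := exists_isLexMax_of_eq hPeq hlex
    exact ⟨x, y, z', q, r, ν, hPxy', hxyz, hPeq, hq, hqr, hν1, hfν, hfν1, hlex'⟩

end Iota3

end Summit.ResolutionOfSingularities.ResolutionOfSingularities.Cruxes.HypersurfaceCentreConstruction.LocalEngine

end
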